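import Summits.CriticalPhenomena.PercolationContinuityZ3.Theorems.Transplant.GrigorchukPowerNcHaraSladeLaceDefs
import Mathlib.Algebra.Order.Chebyshev
import Mathlib.Combinatorics.SimpleGraph.Metric
import HarnessLib

/-!
# W4 — lace-norm lemmas over DEFS-C: `ω_ξ(x) = ½‖ξ − ρ(x)ξ‖²`, the critic's bound `ω_ξ(x) ≤ 4k·|x|²·κ₀(ξ)`, and finiteness of `laceNormE` under a second moment

Proof file (`--supports stmt-CriticalPhenomena-4575 --as helper`), lane `prim-bschramm`, seat `prim-bschramm-gen-1` gen 12 (GEN pen); the S support item «LaceNormLemmas» of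
lead g29 #9936 over DEFS-C «GrigorchukPowerNcHaraSladeLaceDefs» (`omegaV`, `kappa0`, `laceNormE`, `laceBound`, `IsLaceKernel`).  builds on p205010 (kernel theorem, internal
audit signed; external expert review pending) — nothing here uses p205010.  Def-free; no instance, no notation, no sorry; stakes no claim and staffs nothing (S3a/S3b untouched):
this is the elementary API the S3b improvement algebra needs regardless of who proves it.

* §1 `tsum_sq_sub_shift_eq`: `Σ_y (ξ(y) − ξ(yx))² = 2 ω_ξ(x)` (finite-support series; right shifts `y ↦ yx` are bijections), `omegaV_one`, `omegaV_inv`.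
* §2 `omegaV_le_mul_sum_steps` (graph-free chain rule: `ω_ξ(v_n) ≤ n Σ_{i<n} ω_ξ(v_i⁻¹v_{i+1})`, telescoping + Cauchy–Schwarz `sq_sum_le_card_mul_sum_sq`),
  `omegaV_le_length_sq_mul`: along a walk `1 → x` in `Cay(𝔊^k)` of length `n`, `ω_ξ(x) ≤ n² · Σ_{s∈S_k} ω_ξ(s)` (each step a right generator by
  «GrigorchukPowerSmallParam» `gkCay_adj_iff`); hence the critic's paper lemma (w-crit-1 g2, Probe-Ω): **`omegaV_le_dist_sq`**: `ω_ξ(x) ≤ 4k · dist(1,x)² · κ₀(ξ)`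
  (`SimpleGraph.dist` of `gkCay k`).  The factor `4k` is sharp for general `ξ` (refuter note N-p5g35-1); the `k`-free bound for coordinate-exchangeable kernels is S3a's.
* §3 `laceNormE_le_of_sq_moment`, **`laceNormE_lt_top_of_sq_moment`**: a kernel with `Σ|K| < ∞` and `Σ |K(x)| dist(1,x)² < ∞` has finite lace norm
  (`≤ ‖K‖₁ ⊔ 4k Σ_x |K(x)| dist(1,x)²`); `laceBound_lt_top_of`, `laceBound_eq_top_iff`.
[cite: HeydenreichVanDerHofstad2017, §8.3 (1 − D̂(k) ≍ |k|²; Prop. 8.3)] [cite: HaraSlade1990, §4 (lace-expansion norms)]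
-/

noncomputable section

namespace Summit.CriticalPhenomena.PercolationContinuityZ3.Theorems.Transplant

namespace Grigorchuk

namespace NcHaraSlade

open SimpleGraph Finset Literature.Probability.Percolation
open scoped ENNReal Classical

variable {k : ℕ}

/-! ## §1 `ω_ξ(x)` as half a squared `ℓ²` distance -/

/-- Support bookkeeping: `ξ(y·a) = 0` unless `y ∈ supp(ξ)·a⁻¹`. [folklore] -/
theorem apply_mul_eq_zero_of_notMem (ξ : GPow k →₀ ℝ) (a : GPow k) {y : GPow k} (hy : y ∉ ξ.support.image (· * a⁻¹)) : ξ (y * a) = 0 := by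
  by_contra h
  exact hy (Finset.mem_image.2 ⟨y * a, Finsupp.mem_support_iff.2 h, mul_inv_cancel_right y a⟩)

/-- `y ↦ (ξ(y a) − ξ(y b))²` has finite support, hence is summable. [folklore] -/
theorem summable_sq_sub (ξ : GPow k →₀ ℝ) (a b : GPow k) : Summable fun y => (ξ (y * a) - ξ (y * b)) ^ 2 := by
  refine summable_of_ne_finset_zero (s := ξ.support.image (· * a⁻¹) ∪ ξ.support.image (· * b⁻¹)) fun y hy => ?_
  rw [Finset.mem_union, not_or] at hy
  rw [apply_mul_eq_zero_of_notMem ξ a hy.1, apply_mul_eq_zero_of_notMem ξ b hy.2]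
  ring

/-- **`Σ_y (ξ(y) − ξ(y x))² = 2 ω_ξ(x)`**: `ω_ξ(x) = ‖ξ‖² − ⟨ξ, ρ(x)ξ⟩ = ½‖ξ − ρ(x)ξ‖²` since the right shift `y ↦ y x` preserves `‖·‖²`.
[cite: HeydenreichVanDerHofstad2017, §8.3] -/
theorem tsum_sq_sub_shift_eq (ξ : GPow k →₀ ℝ) (x : GPow k) : ∑' y, (ξ y - ξ (y * x)) ^ 2 = 2 * omegaV ξ x := by
  have hS0 : ∀ y ∉ ξ.support, ξ y * ξ y = 0 := fun y hy => by rw [Finsupp.notMem_support_iff.1 hy, zero_mul]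
  have hS1 : ∀ y ∉ ξ.support, ξ y * ξ (y * x) = 0 := fun y hy => by rw [Finsupp.notMem_support_iff.1 hy, zero_mul]
  have h0 : ∑' y, ξ y * ξ y = ∑ y ∈ ξ.support, ξ y * ξ y := tsum_eq_sum hS0
  have h1 : ∑' y, ξ y * ξ (y * x) = ∑ y ∈ ξ.support, ξ y * ξ (y * x) := tsum_eq_sum hS1
  have h2 : ∑' y, ξ (y * x) * ξ (y * x) = ∑ y ∈ ξ.support, ξ y * ξ y :=
    ((Equiv.mulRight x).tsum_eq fun y => ξ y * ξ y).trans h0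
  have hsum0 : Summable fun y => ξ y * ξ y := summable_of_ne_finset_zero hS0
  have hsum1 : Summable fun y => ξ y * ξ (y * x) := summable_of_ne_finset_zero hS1
  have hsum2 : Summable fun y => ξ (y * x) * ξ (y * x) := (Equiv.mulRight x).summable_iff.2 hsum0
  calc ∑' y, (ξ y - ξ (y * x)) ^ 2 = ∑' y, ((ξ y * ξ y - 2 * (ξ y * ξ (y * x))) + ξ (y * x) * ξ (y * x)) :=
        tsum_congr fun y => by ring
    _ = (∑' y, ξ y * ξ y - 2 * ∑' y, ξ y * ξ (y * x)) + ∑' y, ξ (y * x) * ξ (y * x) := by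
        rw [(hsum0.sub (hsum1.mul_left 2)).tsum_add hsum2, hsum0.tsum_sub (hsum1.mul_left 2), tsum_mul_left]
    _ = 2 * omegaV ξ x := by
        rw [h0, h1, h2]
        unfold omegaV
        ring

/-- Shifted form: `Σ_y (ξ(y u) − ξ(y u s))² = 2 ω_ξ(s)`. [folklore] -/
theorem tsum_sq_sub_shift_shift (ξ : GPow k →₀ ℝ) (u s : GPow k) : ∑' y, (ξ (y * u) - ξ (y * u * s)) ^ 2 = 2 * omegaV ξ s := by
  rw [← tsum_sq_sub_shift_eq]
  exact (Equiv.mulRight u).tsum_eq fun y => (ξ y - ξ (y * s)) ^ 2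

/-- `ω_ξ(1) = 0`. [folklore] -/
theorem omegaV_one (ξ : GPow k →₀ ℝ) : omegaV ξ 1 = 0 := by
  unfold omegaV
  simp only [mul_one, sub_self]

/-- `ω_ξ(x⁻¹) = ω_ξ(x)`. [folklore] -/
theorem omegaV_inv (ξ : GPow k →₀ ℝ) (x : GPow k) : omegaV ξ x⁻¹ = omegaV ξ x := by
  have h := tsum_sq_sub_shift_shift ξ x x⁻¹
  simp only [mul_inv_cancel_right] at h
  have h' : ∑' y, (ξ (y * x) - ξ y) ^ 2 = ∑' y, (ξ y - ξ (y * x)) ^ 2 := tsum_congr fun y => by ring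
  rw [h', tsum_sq_sub_shift_eq] at h
  linarith

/-! ## §2 `ω_ξ` along chains and walks: the critic's bound `ω_ξ(x) ≤ 4k · |x|² · κ₀(ξ)` -/

/-- **Chain rule for `ω_ξ` (graph-free): `ω_ξ(v_n) ≤ n · Σ_{i<n} ω_ξ(v_i⁻¹ v_{i+1})`** for every sequence `v` in `𝔊^k` with `v_0 = 1` — telescoping
`ξ − ρ(v_n)ξ = Σ_i ρ(v_i)(ξ − ρ(v_i⁻¹v_{i+1})ξ)` and Cauchy–Schwarz (`ω_ξ = ½‖ξ − ρ(·)ξ‖²`, right shifts are isometries).  The anisotropic / per-coordinate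
refinements S3a needs (refuter note N-p5g35-1) start from this form. [cite: HeydenreichVanDerHofstad2017, §8.3] -/
theorem omegaV_le_mul_sum_steps (ξ : GPow k →₀ ℝ) (v : ℕ → GPow k) (h0 : v 0 = 1) (n : ℕ) :
    omegaV ξ (v n) ≤ (n : ℝ) * ∑ i ∈ Finset.range n, omegaV ξ ((v i)⁻¹ * v (i + 1)) := by
  set s : ℕ → GPow k := fun i => (v i)⁻¹ * v (i + 1) with hs
  have hvs : ∀ i, v (i + 1) = v i * s i := fun i => by rw [hs, mul_inv_cancel_left]
  -- pointwise telescoping + Cauchy–Schwarz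
  have hpt : ∀ y : GPow k, (ξ y - ξ (y * v n)) ^ 2 ≤ (n : ℝ) * ∑ i ∈ Finset.range n, (ξ (y * v i) - ξ (y * v i * s i)) ^ 2 := by
    intro y
    have htel : ξ y - ξ (y * v n) = ∑ i ∈ Finset.range n, (ξ (y * v i) - ξ (y * v i * s i)) := by
      calc ξ y - ξ (y * v n) = ξ (y * v 0) - ξ (y * v n) := by rw [h0, mul_one]
        _ = ∑ i ∈ Finset.range n, (ξ (y * v i) - ξ (y * v (i + 1))) := (Finset.sum_range_sub' (fun i => ξ (y * v i)) n).symm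
        _ = ∑ i ∈ Finset.range n, (ξ (y * v i) - ξ (y * v i * s i)) :=
            Finset.sum_congr rfl fun i _ => by rw [hvs i, mul_assoc]
    rw [htel]
    have h := sq_sum_le_card_mul_sum_sq (s := Finset.range n) (f := fun i => ξ (y * v i) - ξ (y * v i * s i))
    rwa [Finset.card_range] at h
  -- summability (finite supports) and summation over `y`
  have hsumL : Summable fun y => (ξ y - ξ (y * v n)) ^ 2 := (summable_sq_sub ξ 1 (v n)).congr fun y => by rw [mul_one]
  have hsumi : ∀ i, Summable fun y => (ξ (y * v i) - ξ (y * v i * s i)) ^ 2 :=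
    fun i => (summable_sq_sub ξ (v i) (v i * s i)).congr fun y => by rw [← mul_assoc]
  have hsumR : Summable fun y => (n : ℝ) * ∑ i ∈ Finset.range n, (ξ (y * v i) - ξ (y * v i * s i)) ^ 2 :=
    (summable_sum fun i _ => hsumi i).mul_left _
  have hle := hsumL.tsum_le_tsum hpt hsumR
  rw [tsum_sq_sub_shift_eq, tsum_mul_left, Summable.tsum_finsetSum (fun i _ => hsumi i)] at hle
  simp only [tsum_sq_sub_shift_shift] at hle
  -- `hle : 2 ω(v n) ≤ n · Σ_i 2 ω(s_i)`
  rw [← Finset.mul_sum] at hle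
  have hre : (n : ℝ) * (2 * ∑ i ∈ Finset.range n, omegaV ξ (s i)) = 2 * ((n : ℝ) * ∑ i ∈ Finset.range n, omegaV ξ (s i)) := by ring
  linarith

/-- **`ω_ξ(x) ≤ n² · Σ_{s∈S_k} ω_ξ(s)`** for every walk `1 → x` of length `n` in `Cay(𝔊^k; std)`: the chain rule along the vertices `w.getVert i` (each step a right
generator, «GrigorchukPowerSmallParam» `gkCay_adj_iff`) and `ω_ξ ≥ 0` (DEFS-C `omegaV_nonneg`). [cite: HeydenreichVanDerHofstad2017, §8.3] -/
theorem omegaV_le_length_sq_mul (ξ : GPow k →₀ ℝ) {x : GPow k} (w : (gkCay k).Walk 1 x) :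
    omegaV ξ x ≤ (w.length : ℝ) ^ 2 * ∑ s ∈ gkGens k, omegaV ξ s := by
  have h := omegaV_le_mul_sum_steps ξ (fun i => w.getVert i) w.getVert_zero w.length
  simp only [Walk.getVert_length] at h
  -- each step is a generator
  have hωs : ∀ i ∈ Finset.range w.length, omegaV ξ ((w.getVert i)⁻¹ * w.getVert (i + 1)) ≤ ∑ s ∈ gkGens k, omegaV ξ s := by
    intro i hi
    obtain ⟨j, y, hj⟩ := gkCay_adj_iff.1 (w.adj_getVert_succ (Finset.mem_range.1 hi))
    rw [hj, inv_mul_cancel_left]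
    exact Finset.single_le_sum (fun t _ => omegaV_nonneg ξ t) (mulSingle_mem_gkGens j (mem_gens_iff.2 ⟨y, rfl⟩))
  have hn0 : (0 : ℝ) ≤ w.length := Nat.cast_nonneg _
  calc omegaV ξ x ≤ (w.length : ℝ) * ∑ i ∈ Finset.range w.length, omegaV ξ ((w.getVert i)⁻¹ * w.getVert (i + 1)) := h
    _ ≤ (w.length : ℝ) * ∑ _i ∈ Finset.range w.length, ∑ s ∈ gkGens k, omegaV ξ s := mul_le_mul_of_nonneg_left (Finset.sum_le_sum hωs) hn0
    _ = (w.length : ℝ) ^ 2 * ∑ s ∈ gkGens k, omegaV ξ s := by rw [Finset.sum_const, Finset.card_range, nsmul_eq_mul]; ring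

/-- `Σ_{s∈S_k} ω_ξ(s) = 4k · κ₀(ξ)` (`k ≥ 1`). [folklore] -/
theorem sum_gkGens_omegaV_eq (hk : 1 ≤ k) (ξ : GPow k →₀ ℝ) : ∑ s ∈ gkGens k, omegaV ξ s = 4 * k * kappa0 k ξ := by
  have hk' : (4 * (k : ℝ)) ≠ 0 := by positivity
  unfold kappa0
  field_simp

/-- **The critic's lemma (w-crit-1 g2, Probe-Ω, paper-only there): `ω_ξ(x) ≤ 4k · dist(1, x)² · κ₀(ξ)`** on `Cay(𝔊^k; std)`, `k ≥ 1` — the nc analogue of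
`1 − cos(k·x) ≤ ½|k|²|x|²` against `1 − D̂(k)`. [cite: HeydenreichVanDerHofstad2017, §8.3 (1 − D̂(k))] -/
theorem omegaV_le_dist_sq (hk : 1 ≤ k) (ξ : GPow k →₀ ℝ) (x : GPow k) :
    omegaV ξ x ≤ 4 * k * ((gkCay k).dist 1 x : ℝ) ^ 2 * kappa0 k ξ := by
  obtain ⟨w, hw⟩ := (gkCay_connected k).exists_walk_length_eq_dist 1 x
  have h := omegaV_le_length_sq_mul ξ w
  rw [hw, sum_gkGens_omegaV_eq hk] at h
  calc omegaV ξ x ≤ ((gkCay k).dist 1 x : ℝ) ^ 2 * (4 * k * kappa0 k ξ) := h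
    _ = 4 * k * ((gkCay k).dist 1 x : ℝ) ^ 2 * kappa0 k ξ := by ring

/-! ## §3 Finiteness of the lace norm under a second moment -/

/-- **`laceNormE k K ≤ ‖K‖₁ ⊔ 4k · Σ_x |K(x)| dist(1,x)²`** when the second moment is summable (`k ≥ 1`): for each test vector `ξ` with `κ₀(ξ) > 0`,
`Σ_x |K(x)| ω_ξ(x) ≤ 4k κ₀(ξ) Σ_x |K(x)| dist(1,x)²` by `omegaV_le_dist_sq`. [cite: HeydenreichVanDerHofstad2017, Prop. 8.3] -/
theorem laceNormE_le_of_sq_moment (hk : 1 ≤ k) (K : GPow k → ℝ) (h2 : Summable fun x => |K x| * ((gkCay k).dist 1 x : ℝ) ^ 2) :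
    laceNormE k K ≤ (∑' x, ENNReal.ofReal |K x|) ⊔ ENNReal.ofReal (4 * k * ∑' x, |K x| * ((gkCay k).dist 1 x : ℝ) ^ 2) := by
  unfold laceNormE
  refine sup_le_sup_left (iSup₂_le fun ξ hξ => ENNReal.ofReal_le_ofReal ?_) _
  have hpt : ∀ x, |K x| * omegaV ξ x ≤ (4 * k * kappa0 k ξ) * (|K x| * ((gkCay k).dist 1 x : ℝ) ^ 2) := fun x => by
    calc |K x| * omegaV ξ x ≤ |K x| * (4 * k * ((gkCay k).dist 1 x : ℝ) ^ 2 * kappa0 k ξ) :=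
          mul_le_mul_of_nonneg_left (omegaV_le_dist_sq hk ξ x) (abs_nonneg _)
      _ = (4 * k * kappa0 k ξ) * (|K x| * ((gkCay k).dist 1 x : ℝ) ^ 2) := by ring
  have hsω : Summable fun x => |K x| * omegaV ξ x :=
    Summable.of_nonneg_of_le (fun x => mul_nonneg (abs_nonneg _) (omegaV_nonneg ξ x)) hpt (h2.mul_left _)
  rw [div_le_iff₀ hξ]
  calc ∑' x, |K x| * omegaV ξ x ≤ ∑' x, (4 * k * kappa0 k ξ) * (|K x| * ((gkCay k).dist 1 x : ℝ) ^ 2) := hsω.tsum_le_tsum hpt (h2.mul_left _)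
    _ = 4 * k * (∑' x, |K x| * ((gkCay k).dist 1 x : ℝ) ^ 2) * kappa0 k ξ := by rw [tsum_mul_left]; ring

/-- **A summable kernel with a summable second moment has FINITE lace norm** (`k ≥ 1`). [cite: HeydenreichVanDerHofstad2017, Prop. 8.3] -/
theorem laceNormE_lt_top_of_sq_moment (hk : 1 ≤ k) {K : GPow k → ℝ} (h1 : Summable fun x => |K x|)
    (h2 : Summable fun x => |K x| * ((gkCay k).dist 1 x : ℝ) ^ 2) : laceNormE k K < ⊤ := by
  refine lt_of_le_of_lt (laceNormE_le_of_sq_moment hk K h2) (sup_lt_iff.2 ⟨?_, ENNReal.ofReal_lt_top⟩)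
  rw [← ENNReal.ofReal_tsum_of_nonneg (fun x => abs_nonneg _) h1]
  exact ENNReal.ofReal_lt_top

/-- `laceBound < ⊤` as soon as one lace kernel has finite lace norm. [folklore] -/
theorem laceBound_lt_top_of {p : unitInterval} {K : GPow k → ℝ} (hK : IsLaceKernel k p K) (hfin : laceNormE k K < ⊤) : laceBound k p < ⊤ :=
  lt_of_le_of_lt (laceBound_le hK) hfin

/-- `laceBound = ⊤` iff every lace kernel (if any) has infinite lace norm. [folklore] -/
theorem laceBound_eq_top_iff {p : unitInterval} : laceBound k p = ⊤ ↔ ∀ K : GPow k → ℝ, IsLaceKernel k p K → laceNormE k K = ⊤ := by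
  unfold laceBound
  rw [iInf₂_eq_top]

end NcHaraSlade

end Grigorchuk

end Summit.CriticalPhenomena.PercolationContinuityZ3.Theorems.Transplant

end
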